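import Summits.CriticalPhenomena.SAWScalingLimit.Theorems.SAWLoopFugacityFlowAvoidanceLimitGreenConvergenceSandwich
import Summits.CriticalPhenomena.SAWScalingLimit.Theorems.SAWLoopFugacityFlowAvoidanceLimitGreenConvergenceEscape
import Summits.CriticalPhenomena.SAWScalingLimit.Theorems.SAWLoopFugacityFlowAvoidanceLimitGreenConvergenceInnerKernel

/-!
# GC along admissible lattice sequences from the printed Chelkak–Wan Cor. 3.3
— helper file of stub `stub_greenConvergence` (GC) of line `symplectic-fermion-anchor`
(crux `SAWLoopFugacityFlow.AvoidanceLimit`, stmt-CriticalPhenomena-10649; lead c2 GC-sandwich programme)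

`tendsto_greenEntry_confined_of_killedGreen_tendsto` (registered sub-goal): ASSUMING the printed
theorem `Literature.Probability.LatticeModels.killedGreen_tendsto_of_kernelConvergence` (Chelkak–Wan 2021
Cor. 3.3 = Chelkak–Smirnov 2011 Thm. 3.9 + 2.5, for simple random walk KILLED AT ITS FIRST VERTEX outside a
hole-free induced lattice domain), the Green's function of the simple random walk of `Ω_δ(D)` killed when
it uses an EDGE whose closed segment leaves `closure D'` — the matrix Green's function
`greenEntry (confinedGraph D D' δ) (meshDomainFinset D δ)` of the line — converges along every pair of
lattice sequences `δ u_δ → z`, `δ v_δ → y` (`z ≠ y` in the Jordan domain `D' ⊆ D`) to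
`(2/π) G_ℍ(ψ⁻¹ z, ψ⁻¹ y)`, `G_ℍ(a, b) = log(|a − b̄|/|a − b|)`, for every conformal `ψ : ℍ → D'`.

Proof: the printed theorem is applied to TWO families of hole-free induced lattice domains that
Carathéodory-converge to `D'` — the inner components `C⁻_δ` (`siteGraph`-component of `nearestSite δ z`
among the bulk sites whose closed `2δ`-ball lies in `D'`; hole-free by `holeFree_innerComponent` +
`escape_of_not_closedBall_subset`, kernel-convergent by `kernelConvergence_inner`) and the outer components
`C⁺_δ` (component of the same base in the hole-fill of `{w | δw ∈ closure D'}`; `holeFree_nonEscaping_component`,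
`kernelConvergence_outer`) — and the edge-killed Green's function is squeezed between the two site-killed
ones (`killedGreen_inner_le_greenEntry`, `greenEntry_le_killedGreen_outer`). So the `(V, E_int)`-extension
of the printed statement that the stub seemed to need is NOT needed.

Sources: [ChelkakWan2021] Cor. 3.3; [ChelkakSmirnov2011] Thm. 3.9; [Lawler1991] §1.5. No definitions;
the printed theorem enters as an explicit hypothesis (named fact, not asserted).
-/

noncomputable section

open scoped BigOperators Topology Pointwise
open Filter Finset
open Literature.Probability.RandomPlanarGeometry Literature.Probability.LatticeModels

namespace Summit.CriticalPhenomena.SAWScalingLimit.Theorems.AvoidanceLimit.Anchor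

/-! ## Small tools -/

/-- Kernel convergence only sees positive meshes: families agreeing for `δ > 0` converge together.
[folklore] -/
theorem kernelConvergence_congr {U U' : ℝ → Set ℂ} {Ω : Set ℂ} (h : ∀ δ, 0 < δ → U' δ = U δ)
    (hU : ChelkakSmirnov.KernelConvergence U Ω) : ChelkakSmirnov.KernelConvergence U' Ω := by
  have hev : ∀ᶠ δ in 𝓝[>] (0 : ℝ), U' δ = U δ :=
    eventually_nhdsWithin_of_forall fun δ hδ => h δ hδ
  refine ⟨fun z hz => ?_, fun a ha ρ hρ => ?_⟩
  · obtain ⟨ρ, hρ, hρU⟩ := hU.1 z hz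
    exact ⟨ρ, hρ, by filter_upwards [hρU, hev] with δ h1 h2; rwa [h2]⟩
  · filter_upwards [hU.2 a ha ρ hρ, hev] with δ h1 h2
    rwa [h2]

/-- A reachability class of `siteGraph A` lies in `A ∪ {base}`. [folklore] -/
theorem setOf_siteGraph_reachable_subset_insert (A : Set (Site 2)) (b : Site 2) :
    {x : Site 2 | (ChordalLERW.siteGraph A).Reachable b x} ⊆ insert b A := by
  intro x hx
  by_cases hxb : x = b
  · exact Or.inl hxb
  · exact Or.inr (mem_of_siteGraph_reachable_of_ne hx.symm hxb)

open scoped Classical in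
/-- The finset of a set that is finite, `∅` otherwise (a total stand-in for `Set.Finite.toFinset`).
[folklore] -/
theorem coe_dite_toFinset {S : Set (Site 2)} (hS : S.Finite) :
    (↑(if h : S.Finite then h.toFinset else (∅ : Finset (Site 2))) : Set (Site 2)) = S := by
  rw [dif_pos hS, Set.Finite.coe_toFinset]

/-- Coordinates of a site of the hole-fill of the closed-domain sites, or of a base site near a point
of the domain, are bounded by `(R₀ + δ)/δ` when `closure D' ⊆ closedBall 0 R₀`. [folklore] -/
theorem mul_abs_apply_le_of_mem_outer {D' : Set ℂ} {δ R₀ : ℝ} (hδ : 0 < δ)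
    (hR : closure D' ⊆ Metric.closedBall (0 : ℂ) R₀) {z : ℂ} (hz : z ∈ D') {x : Site 2}
    (hx : x ∈ insert (nearestSite δ z) {g : Site 2 | ¬ ∀ M : ℤ, ∃ g' : Site 2, M ≤ g' 1 ∧
      Relation.ReflTransGen (FaceStep {w : Site 2 | meshPoint δ w ∈ closure D'}) g g'}) (i : Fin 2) :
    δ * |((x i : ℤ) : ℝ)| ≤ R₀ + δ := by
  have hR0 : 0 ≤ R₀ := by
    have := hR (subset_closure hz)
    rw [Metric.mem_closedBall, dist_zero_right] at this
    exact (norm_nonneg _).trans this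
  rcases hx with rfl | hx
  · -- the base site: its mesh point is within `δ` of `z`, `‖z‖ ≤ R₀`
    have hzn : ‖z‖ ≤ R₀ := by simpa using hR (subset_closure hz)
    have hd := dist_meshPoint_nearestSite_le hδ z
    have hcoord : |(meshPoint δ (nearestSite δ z)).re| ≤ R₀ + δ ∧
        |(meshPoint δ (nearestSite δ z)).im| ≤ R₀ + δ := by
      have hn : ‖meshPoint δ (nearestSite δ z)‖ ≤ R₀ + δ := by
        have := norm_le_of_mem_closedBall (Metric.mem_closedBall.2 hd)
        calc ‖meshPoint δ (nearestSite δ z)‖ ≤ ‖z‖ + dist (meshPoint δ (nearestSite δ z)) z := by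
              rw [dist_eq_norm]; exact norm_le_insert' _ _
          _ ≤ R₀ + δ := add_le_add hzn hd
      exact ⟨(Complex.abs_re_le_norm _).trans hn, (Complex.abs_im_le_norm _).trans hn⟩
    fin_cases i
    · have h := hcoord.1
      rw [meshPoint_re, abs_mul, abs_of_pos hδ] at h
      exact h
    · have h := hcoord.2
      rw [meshPoint_im, abs_mul, abs_of_pos hδ] at h
      exact h
  · obtain ⟨h0, h1⟩ := nonEscaping_subset_box {w : Site 2 | meshPoint δ w ∈ closure D'} ⌈R₀ / δ⌉₊
      (fun v hv => abs_le_of_meshPoint_mem hδ hR hv) hx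
    have hceil : δ * ((⌈R₀ / δ⌉₊ : ℕ) : ℝ) ≤ R₀ + δ := by
      have := (Nat.ceil_lt_add_one (div_nonneg hR0 hδ.le)).le
      calc δ * ((⌈R₀ / δ⌉₊ : ℕ) : ℝ) ≤ δ * (R₀ / δ + 1) := by gcongr
        _ = R₀ + δ := by field_simp
    have key : ∀ a : ℤ, |a| ≤ ((⌈R₀ / δ⌉₊ : ℕ) : ℤ) → δ * |((a : ℤ) : ℝ)| ≤ R₀ + δ := fun a ha => by
      have ha' : |((a : ℤ) : ℝ)| ≤ ((⌈R₀ / δ⌉₊ : ℕ) : ℝ) := by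
        rw [← Int.cast_abs]; exact_mod_cast ha
      exact (mul_le_mul_of_nonneg_left ha' hδ.le).trans hceil
    fin_cases i
    · exact key _ h0
    · exact key _ h1

/-! ## The registered sub-goal -/

/-- **GC along lattice sequences, from the printed Chelkak–Wan Cor. 3.3.** Assuming
`killedGreen_tendsto_of_kernelConvergence`: for Jordan domains `D' ⊆ D`, a conformal `ψ : ℍ → D'`, distinct
`z, y ∈ D'` and lattice sequences with `δu_δ → z`, `δv_δ → y` (`δ → 0⁺`), the confined matrix Green's function
`greenEntry (confinedGraph D D' δ) (meshDomainFinset D δ) u_δ v_δ` tends to `(2/π) G_ℍ(ψ⁻¹z, ψ⁻¹y)`.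
Squeeze between the printed theorem applied to the inner and to the outer hole-free approximants.
[cite: ChelkakWan2021, Corollary 3.3 (§3.1)] -/
theorem tendsto_greenEntry_confined_of_killedGreen_tendsto :
    killedGreen_tendsto_of_kernelConvergence →
    ∀ (D D' : JordanDomain), D'.carrier ⊆ D.carrier →
      ∀ (ψ : ConformalEquiv UpperHalfPlane.upperHalfPlaneSet D'.carrier) (z y : ℂ),
      z ∈ D'.carrier → y ∈ D'.carrier → z ≠ y →
      ∀ (uδ vδ : ℝ → Site 2),
      Tendsto (fun δ : ℝ => meshPoint δ (uδ δ)) (𝓝[>] 0) (𝓝 z) →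
      Tendsto (fun δ : ℝ => meshPoint δ (vδ δ)) (𝓝[>] 0) (𝓝 y) →
      Tendsto (fun δ : ℝ => greenEntry (confinedGraph D.carrier D'.carrier δ) (meshDomainFinset D.carrier δ)
        (uδ δ) (vδ δ)) (𝓝[>] 0)
        (𝓝 (2 / Real.pi * Real.log (‖ψ.symm z - (starRingEnd ℂ) (ψ.symm y)‖ / ‖ψ.symm z - ψ.symm y‖))) := by
  intro hCW D D' hsub ψ z y hz hy hne uδ vδ hu hv
  classical
  -- a common large ball
  obtain ⟨R₀, hR₀⟩ := (Metric.isBounded_iff_subset_closedBall (0 : ℂ)).1 D'.isBounded.closure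
  have hR0 : 0 ≤ R₀ := by
    have := hR₀ (subset_closure hz)
    rw [Metric.mem_closedBall, dist_zero_right] at this
    exact (norm_nonneg _).trans this
  set R : ℝ := 2 * R₀ + 10 with hR_def
  have hD'R : D'.carrier ⊆ Metric.ball (0 : ℂ) R := fun w hw => by
    have := hR₀ (subset_closure hw)
    rw [Metric.mem_closedBall, dist_zero_right] at this
    rw [Metric.mem_ball, dist_zero_right]
    linarith
  -- notation-free names for the two families
  set Inner : ℝ → Set (Site 2) := fun δ => {w : Site 2 | w ∈ meshDomain D.carrier δ ∧
    Metric.closedBall (meshPoint δ w) (2 * δ) ⊆ D'.carrier} with hInner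
  set Vcl : ℝ → Set (Site 2) := fun δ => {w : Site 2 | meshPoint δ w ∈ closure D'.carrier} with hVcl
  set NE : ℝ → Set (Site 2) := fun δ => {g : Site 2 | ¬ ∀ M : ℤ, ∃ g' : Site 2, M ≤ g' 1 ∧
    Relation.ReflTransGen (FaceStep (Vcl δ)) g g'} with hNE
  set Cin : ℝ → Set (Site 2) := fun δ =>
    {x : Site 2 | (ChordalLERW.siteGraph (Inner δ)).Reachable (nearestSite δ z) x} with hCin
  set Cout : ℝ → Set (Site 2) := fun δ =>
    {x : Site 2 | (ChordalLERW.siteGraph (NE δ)).Reachable (nearestSite δ z) x} with hCout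
  -- finiteness for positive mesh
  have hfin_in : ∀ δ, 0 < δ → (Cin δ).Finite := fun δ hδ =>
    ((meshDomain_finite D.isBounded hδ).insert (nearestSite δ z)).subset
      ((setOf_siteGraph_reachable_subset_insert (Inner δ) _).trans
        (Set.insert_subset_insert fun w hw => hw.1))
  have hfin_out : ∀ δ, 0 < δ → (Cout δ).Finite := fun δ hδ =>
    ((finite_nonEscaping D'.isBounded hδ).insert (nearestSite δ z)).subset
      (setOf_siteGraph_reachable_subset_insert (NE δ) _)
  set Ain : ℝ → Finset (Site 2) := fun δ => if h : (Cin δ).Finite then h.toFinset else ∅ with hAin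
  set Aout : ℝ → Finset (Site 2) := fun δ => if h : (Cout δ).Finite then h.toFinset else ∅ with hAout
  have hAin_coe : ∀ δ, 0 < δ → (↑(Ain δ) : Set (Site 2)) = Cin δ := fun δ hδ => coe_dite_toFinset (hfin_in δ hδ)
  have hAout_coe : ∀ δ, 0 < δ → (↑(Aout δ) : Set (Site 2)) = Cout δ := fun δ hδ =>
    coe_dite_toFinset (hfin_out δ hδ)
  -- eventual facts about the base site
  have hpos : ∀ᶠ δ in 𝓝[>] (0 : ℝ), 0 < δ ∧ δ < 1 := by
    filter_upwards [Ioo_mem_nhdsGT (zero_lt_one' ℝ)] with δ hδ using ⟨hδ.1, hδ.2⟩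
  have hbase_in := InnerKernel.eventually_nearestSite_mem_inner D D' hsub hz
  -- (1) the printed theorem for the INNER family
  have hdisc_in : ∀ᶠ δ in 𝓝[>] (0 : ℝ), ChelkakSmirnov.IsDiscreteDomain (Ain δ) ∧
      δ • ChelkakSmirnov.starDomain (↑(Ain δ) : Set (Site 2)) ⊆ Metric.ball (0 : ℂ) R := by
    filter_upwards [hpos, hbase_in] with δ hδ hb
    have hcoe := hAin_coe δ hδ.1
    have hbI : nearestSite δ z ∈ Inner δ := hb
    refine ⟨⟨?_, ?_, ?_⟩, ?_⟩
    · rw [← Finset.coe_nonempty, hcoe]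
      exact ⟨nearestSite δ z, SimpleGraph.Reachable.refl _⟩
    · rw [hcoe]
      exact induce_setOf_reachable_connected (Inner δ) (nearestSite δ z)
    · rw [hcoe]
      exact holeFree_innerComponent D D' δ (nearestSite δ z) hδ.1 hsub
        (escape_of_not_closedBall_subset D' δ hδ.1) hb.1 hb.2
    · rw [hcoe]
      refine (InnerKernel.smul_starDomain_subset hδ.1 (S := D'.carrier) fun x hx => ?_).trans hD'R
      exact (InnerKernel.mem_of_siteGraph_reachable hbI hx).2
  have hkc_in : ChelkakSmirnov.KernelConvergence
      (fun δ => δ • ChelkakSmirnov.starDomain (↑(Ain δ) : Set (Site 2))) D'.carrier :=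
    kernelConvergence_congr (U := fun δ => δ • ChelkakSmirnov.starDomain (Cin δ))
      (fun δ hδ => by rw [hAin_coe δ hδ]) (kernelConvergence_inner D D' z hsub hz)
  -- compact neighbourhoods of the two limit points inside `D'`
  obtain ⟨r, hr, hrsub⟩ : ∃ r : ℝ, 0 < r ∧
      Metric.closedBall z r ∪ Metric.closedBall y r ⊆ D'.carrier := by
    obtain ⟨r₁, hr₁, h₁⟩ := Metric.isOpen_iff.1 D'.isOpen z hz
    obtain ⟨r₂, hr₂, h₂⟩ := Metric.isOpen_iff.1 D'.isOpen y hy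
    refine ⟨min r₁ r₂ / 2, by positivity, Set.union_subset ?_ ?_⟩
    · exact (Metric.closedBall_subset_ball (by linarith [min_le_left r₁ r₂])).trans h₁
    · exact (Metric.closedBall_subset_ball (by linarith [min_le_right r₁ r₂])).trans h₂
  have hK : IsCompact (Metric.closedBall z r ∪ Metric.closedBall y r) :=
    (isCompact_closedBall z r).union (isCompact_closedBall y r)
  have hu_near : ∀ᶠ δ in 𝓝[>] (0 : ℝ), meshPoint δ (uδ δ) ∈ Metric.closedBall z r :=
    hu (Metric.closedBall_mem_nhds z hr)
  have hv_near : ∀ᶠ δ in 𝓝[>] (0 : ℝ), meshPoint δ (vδ δ) ∈ Metric.closedBall y r :=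
    hv (Metric.closedBall_mem_nhds y hr)
  have hmem_in_set : ∀ᶠ δ in 𝓝[>] (0 : ℝ), uδ δ ∈ Cin δ ∧ vδ δ ∈ Cin δ := by
    filter_upwards [eventually_mem_innerComponent D D' z _ hsub hz hK hrsub, hu_near, hv_near]
      with δ hδ hun hvn
    exact ⟨hδ _ (Or.inl hun), hδ _ (Or.inr hvn)⟩
  have hmem_in : ∀ᶠ δ in 𝓝[>] (0 : ℝ), uδ δ ∈ Ain δ ∧ vδ δ ∈ Ain δ := by
    filter_upwards [hmem_in_set, hpos] with δ hm hδ
    rw [← Finset.mem_coe, ← Finset.mem_coe, hAin_coe δ hδ.1]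
    exact hm
  have hlim_in := hCW D'.carrier R D'.isOpen hD'R ψ Ain hdisc_in hkc_in z y hz hy hne uδ vδ hmem_in hu hv
  -- (2) the printed theorem for the OUTER family
  have hdisc_out : ∀ᶠ δ in 𝓝[>] (0 : ℝ), ChelkakSmirnov.IsDiscreteDomain (Aout δ) ∧
      δ • ChelkakSmirnov.starDomain (↑(Aout δ) : Set (Site 2)) ⊆ Metric.ball (0 : ℂ) R := by
    filter_upwards [hpos] with δ hδ
    have hcoe := hAout_coe δ hδ.1
    refine ⟨⟨?_, ?_, ?_⟩, ?_⟩
    · rw [← Finset.coe_nonempty, hcoe]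
      exact ⟨nearestSite δ z, SimpleGraph.Reachable.refl _⟩
    · rw [hcoe]
      exact induce_setOf_reachable_connected (NE δ) (nearestSite δ z)
    · rw [hcoe]
      exact holeFree_nonEscaping_component (Vcl δ) (nearestSite δ z)
    · rw [hcoe]
      intro w hw
      obtain ⟨x, hx, hre, him⟩ := (InnerKernel.mem_smul_starDomain_iff hδ.1).1 hw
      have hx' := setOf_siteGraph_reachable_subset_insert (NE δ) (nearestSite δ z) hx
      have h0 := mul_abs_apply_le_of_mem_outer hδ.1 hR₀ hz hx' 0
      have h1 := mul_abs_apply_le_of_mem_outer hδ.1 hR₀ hz hx' 1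
      rw [Metric.mem_ball, dist_zero_right]
      have hwre : |w.re| ≤ R₀ + 2 * δ := by
        have h := abs_add_le (w.re - δ * ((x 0 : ℤ) : ℝ)) (δ * ((x 0 : ℤ) : ℝ))
        rw [sub_add_cancel, abs_mul, abs_of_pos hδ.1] at h
        linarith
      have hwim : |w.im| ≤ R₀ + 2 * δ := by
        have h := abs_add_le (w.im - δ * ((x 1 : ℤ) : ℝ)) (δ * ((x 1 : ℤ) : ℝ))
        rw [sub_add_cancel, abs_mul, abs_of_pos hδ.1] at h
        linarith
      calc ‖w‖ ≤ |w.re| + |w.im| := Complex.norm_le_abs_re_add_abs_im w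
        _ < R := by rw [hR_def]; linarith
  have hkc_out : ChelkakSmirnov.KernelConvergence
      (fun δ => δ • ChelkakSmirnov.starDomain (↑(Aout δ) : Set (Site 2))) D'.carrier :=
    kernelConvergence_congr (U := fun δ => δ • ChelkakSmirnov.starDomain (Cout δ))
      (fun δ hδ => by rw [hAout_coe δ hδ]) (kernelConvergence_outer D' z hz)
  have hmem_out_set : ∀ᶠ δ in 𝓝[>] (0 : ℝ), uδ δ ∈ Cout δ ∧ vδ δ ∈ Cout δ := by
    filter_upwards [eventually_mem_outerComponent D' z _ hz hK hrsub, hu_near, hv_near]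
      with δ hδ hun hvn
    exact ⟨hδ _ (Or.inl hun), hδ _ (Or.inr hvn)⟩
  have hmem_out : ∀ᶠ δ in 𝓝[>] (0 : ℝ), uδ δ ∈ Aout δ ∧ vδ δ ∈ Aout δ := by
    filter_upwards [hmem_out_set, hpos] with δ hm hδ
    rw [← Finset.mem_coe, ← Finset.mem_coe, hAout_coe δ hδ.1]
    exact hm
  have hlim_out := hCW D'.carrier R D'.isOpen hD'R ψ Aout hdisc_out hkc_out z y hz hy hne uδ vδ
    hmem_out hu hv
  -- (3) squeeze
  refine tendsto_of_tendsto_of_tendsto_of_le_of_le' hlim_in hlim_out ?_ ?_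
  · filter_upwards [hpos, hbase_in, hmem_in_set] with δ hδ hb hm
    rw [hAin_coe δ hδ.1]
    exact killedGreen_inner_le_greenEntry D D' δ _ _ _ hδ.1 hsub hb hm.1 hm.2
  · filter_upwards [hpos, hmem_out_set] with δ hδ hm
    rw [hAout_coe δ hδ.1]
    exact greenEntry_le_killedGreen_outer D.carrier D'.carrier δ _ _ _ D.isBounded D'.isBounded hδ.1 hm.1

end Summit.CriticalPhenomena.SAWScalingLimit.Theorems.AvoidanceLimit.Anchor

end
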